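import Literature.Probability.Percolation.FlipFairKernel
import Summits.CriticalPhenomena.CardyFormulaZ2.Theorems.CardyMeckeFlipMeckeRigidityPivotalCarrier

/-!
# Cylinder locality of the flip identity (F)

Route `Summits/CriticalPhenomena/CardyFormulaZ2/Theses/CardyMeckeFlip`, crux `MeckeRigidity`
(item stmt-CriticalPhenomena-14826), line `registered`, stub `stub_crossingUniqueness` (helper).

Clause (F) of the crux (`IsFlipFairKernel P K`) says that the Campbell measure `P(dS) K(S)(dx)` is
invariant under the pivotal involution on cylinder test functions: for every finite family of
quads `Q`, every `g` and every `φ ∈ C_c(ℂ)`,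
`∫ S, ∫ x, φ x * g {i | Qᵢ ∈ S} ∂(K S) ∂P = ∫ S, ∫ x, φ x * g (toggled pattern) ∂(K S) ∂P`,
where the toggled pattern is `{i | Qᵢ ∈ S} Δ {i | Piv S x Qᵢ}`.  This file proves its
**cylinder locality**: if a second finite family of quads `Qf` has carriers disjoint from
`tsupport φ`, then multiplying both outer integrands by any function `G {j | Qf j ∈ S}` of its
crossing pattern preserves the identity (`IsFlipFairKernel.integral_cylinder_mul_eq`, registered
`∀`-form `flipFair_integral_cylinder_mul_eq` at the end).  Reason: pivotal points of a quad lie in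
its (compact) carrier (`IsPivotalAt.mem_carrier`, file `…MeckeRigidityPivotalCarrier`), so on
`tsupport φ` flipping toggles no `Qf j`, and (F) applied to the appended family `Fin.append Q Qf`
with the product test function `g · G` is the claim.  This is the first step of
"flip-extremal ⟹ spatially ergodic": densities built from far-away quads pass through the flip
identity.
-/

noncomputable section

open MeasureTheory Set Metric
open Literature.Probability.Percolation Literature.Probability.Percolation.QuadCrossing

namespace Summit.CriticalPhenomena.CardyFormulaZ2.Theorems.CardyMeckeFlip

variable {D : Set ℂ}

/-- The pointwise identity behind cylinder locality: against a test function `φ` whose support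
misses the carriers of `Qf`, the product test function `g(·) * G(·)` of the appended family,
evaluated on the toggled patterns, factors as `G {j | Qf j ∈ S} * (φ x * g (toggled Q-pattern))`
(on `tsupport φ` no `Qf j` is pivotal at `x`; off it `φ x = 0`). [folklore] -/
private theorem mul_toggled_mul_eq {n m : ℕ} (S : QuadConfig D) (x : ℂ) (Q : Fin n → Quad D)
    (g : Set (Fin n) → ℝ) {φ : ℂ → ℝ} (Qf : Fin m → Quad D) (G : Set (Fin m) → ℝ)
    (hfar : ∀ j, Disjoint (Qf j).carrier (tsupport φ)) :
    φ x * (g {i | Xor (Q i ∈ S) (S.IsPivotalAt x (Q i))} *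
        G {j | Xor (Qf j ∈ S) (S.IsPivotalAt x (Qf j))}) =
      G {j | Qf j ∈ S} * (φ x * g {i | Xor (Q i ∈ S) (S.IsPivotalAt x (Q i))}) := by
  by_cases hx : x ∈ tsupport φ
  · rw [setOf_xor_isPivotalAt_eq_of_forall_not_mem S x Qf
      fun j hxj => Set.disjoint_left.mp (hfar j) hxj hx]
    ring
  · rw [image_eq_zero_of_notMem_tsupport hx, zero_mul, zero_mul, mul_zero]

/-- **Cylinder locality of (F).**  If `K` is a flip-fair kernel for `P` and the carriers of the
quads `Qf j` miss `tsupport φ`, then for every function `G` of the crossing pattern of `Qf`,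
`∫ S, G {j | Qf j ∈ S} * ∫ x, φ x * g {i | Qᵢ ∈ S} ∂(K S) ∂P
  = ∫ S, G {j | Qf j ∈ S} * ∫ x, φ x * g ({i | Qᵢ ∈ S} Δ {i | Piv S x Qᵢ}) ∂(K S) ∂P`:
(F) for the appended family `Fin.append Q Qf` and the test function `g · G`, in which the
`G`-factor is never toggled on `tsupport φ`. [folklore] -/
theorem IsFlipFairKernel.integral_cylinder_mul_eq {P : Measure (QuadConfig D)}
    {K : QuadConfig D → Measure ℂ} (hF : IsFlipFairKernel P K) {n : ℕ} (Q : Fin n → Quad D)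
    (g : Set (Fin n) → ℝ) {φ : ℂ → ℝ} (hφ : Continuous φ) (hφc : HasCompactSupport φ) {m : ℕ}
    (Qf : Fin m → Quad D) (G : Set (Fin m) → ℝ)
    (hfar : ∀ j, Disjoint (Qf j).carrier (tsupport φ)) :
    ∫ S, G {j | Qf j ∈ S} * ∫ x, φ x * g {i | Q i ∈ S} ∂(K S) ∂P =
      ∫ S, G {j | Qf j ∈ S} *
        ∫ x, φ x * g {i | Xor (Q i ∈ S) (S.IsPivotalAt x (Q i))} ∂(K S) ∂P := by
  have key := hF (n + m) (Fin.append Q Qf)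
    (fun B => g {i | Fin.castAdd m i ∈ B} * G {j | Fin.natAdd n j ∈ B}) φ hφ hφc
  simp only [mem_setOf_eq, Fin.append_left, Fin.append_right] at key
  have hL : ∀ (S : QuadConfig D) (x : ℂ),
      φ x * (g {i | Q i ∈ S} * G {j | Qf j ∈ S}) = G {j | Qf j ∈ S} * (φ x * g {i | Q i ∈ S}) :=
    fun S x => by ring
  simp only [hL, mul_toggled_mul_eq _ _ Q g Qf G hfar, integral_const_mul] at key
  exact key

/-- **Cylinder locality of (F), registered form** (sub-goal `flipFair_integral_cylinder_mul_eq` of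
item stmt-CriticalPhenomena-14826): densities built from far-away quads pass through the flip
identity. [folklore] -/
theorem flipFair_integral_cylinder_mul_eq : ∀ (D : Set ℂ) (P : Measure (QuadConfig D)) (K : QuadConfig D → Measure ℂ), IsFlipFairKernel P K → ∀ (n : ℕ) (Q : Fin n → Quad D) (g : Set (Fin n) → ℝ) (φ : ℂ → ℝ), Continuous φ → HasCompactSupport φ → ∀ (m : ℕ) (Qf : Fin m → Quad D) (G : Set (Fin m) → ℝ), (∀ j, Disjoint (Qf j).carrier (tsupport φ)) → ∫ S, G {j | Qf j ∈ S} * ∫ x, φ x * g {i | Q i ∈ S} ∂(K S) ∂P = ∫ S, G {j | Qf j ∈ S} * ∫ x, φ x * g {i | Xor (Q i ∈ S) (S.IsPivotalAt x (Q i))} ∂(K S) ∂P := by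
  intro D P K hF n Q g φ hφ hφc m Qf G hfar
  exact IsFlipFairKernel.integral_cylinder_mul_eq hF Q g hφ hφc Qf G hfar

end Summit.CriticalPhenomena.CardyFormulaZ2.Theorems.CardyMeckeFlip

end
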